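/-
Copyright (c) 2026 the pub-hodgecm-mathlib formalisation cell (harness21).  Prover seat hodgecm-mathlib-LH10-p01 (g13): road M6 → F5 → dyadic chain of `stub_DyUnramCore` (D-UNR),
site (L2-3) «THE WALL», «DEEP-DENOMINATORS-θ» — the type-(2) denominators of the hermitian shift are units by 2-DEEPNESS ALONE (no discriminant law, no unitarity, no `2`);
2026-09-03.
-/
import Literature.NumberTheory.Rogawski1990.TypeTwoCayleyShiftBindersCM       -- ★ γ₃ (F0P2-p06 (g10)): `map_smul_add_smul_one`, `smul_reindex_add_smul_one`, `smul_fromBlocks_add_smul_one`, `isUnit_localRing_of_ne_zero_of_subsingleton`; brings ★ γ₂ (carriers), γ₁ (`shift_parameter_facts`, `eq_one_add_smul_inv_smul_sub_one`)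
import Literature.NumberTheory.Automorphic.UnitaryLatticeTreeLevelShift       -- ★ p845386: `v_det_eq_one_of_forall_v_sub_one_lt_one` (`M ≡ 1 (𝔪)` ⇒ `|det M| = 1`)
import Literature.NumberTheory.Automorphic.TypeTwoHermitianMoebiusShiftValued  -- ★ P2 p853646 (LH10-p01 (g12)): `smul_one_add_smul_add_smul_one_of_add_eq` (`a•(1 + c•X) + b•1 = c•(1 + a•X)`, `a + b = c`)
import HarnessLib

/-!
# The hermitian-shift denominators of a 2-DEEP type-(2) `γ_H` are units — at every residue characteristic, without the discriminant law

Topic `NumberTheory/Rogawski1990`; namespace `Literature.NumberTheory.Rogawski1990`.  THEOREMS ONLY (no definition, no instance, no notation, no named fact, no `sorry`); kernel lane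
`--supports stmt-HodgeConjecture-24833`.  Cell `pub/hodgecm-mathlib` (D-0151), crux H413 = `stmt-HodgeConjecture-24833`; road M6 → F5 → the dyadic chain of organ (D-UNR)
`stub_DyUnramCore`, LEVEL TWO, site (L2-3) «THE WALL» = ★ `liftInterior_of_levelTwo` with its `h2 : IsUnit 2` deleted.

WHY THIS FILE.  The wall's type-(2) branch obtains its eleven denominator facts at ★ :354 from ★ γ₃ `isUnit_shift_denominators_of_typeTwo … h2w hg1 hu1 hN1 hN`, i.e. from
LEVEL-1 deepness plus the ODD discriminant law `hN : |tr² g_w − 4 det g_w| = exp(−(2N+1))` (★ `exists_valued_disc_eq_exp_neg_odd_of_not_exists_isRoot … h2 …`, ★ :321 via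
`exists_irredExponents_of_hint … h2V …` — a `2`-site OUTSIDE the eight rows of CENSUS-L23-CM v1).  At a DYADIC inert place the odd law is FALSE in general (the ramified
quadratic `L_w(√−1)∕L_w` has EVEN discriminant exponent), so no port can feed `hN` there; the dyadic exponent bookkeeping is the EISENSTEIN DATA of ★ (P2d-α)
`exists_eisensteinData_at_place` (as in the dyadic (P-2) clause ★ p853499).  But the wall's `γ_H` is 2-DEEP (`g_w ≡ 1`, `u_w ≡ 1 (mod c_w²)`, ★ :190–:197 `hg2w hu2w hg2c hu2c`),
and for a 2-deep `γ_H` the denominators of the hermitian shift `φ_θ = (θ•_ + (c−θ)•1)((c−θ′)•_ + θ′•1)⁻¹` (`θ + θ′ = 1`, `θ` integral) are units for a TRIVIAL reason: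
`(c−θ′)•g + θ′•1 = c•(1 + (c−θ′)X)`, `θ•g + (c−θ)•1 = c•(1 + θX)` with `X = c⁻¹(g − 1) ≡ 0 (mod c)` (★ P2 `smul_one_add_smul_add_smul_one_of_add_eq`,
★ `v_det_eq_one_of_forall_v_sub_one_lt_one`), and `(c−θ′)u + θ′ = c(1 + (c−θ′)y)`, `θu + (c−θ) = c(1 + θy)` with `y = c⁻¹(u − 1) ≡ 0 (mod c)`.  THIS FILE states the
ELEVEN conjuncts of ★ γ₃ :91 ∕ «BINDERS-θ TYPE (2)» §1 (`isUnit_hermitianShift_denominators_of_typeTwo`, LH7-p04 (g13)) IN THE SAME ORDER AND SYNTACTIC FORM with the pair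
`(c+1, c−1 ∣ c−1, c+1) ↦ (θ, c−θ ∣ c−θ′, θ′)`, from the binders `(hc) (hθ : θ + θ′ = 1) (hθv : |θ_w| ≤ 1) (hg2) (hu2)` only — so the dyadic port of the wall swaps ★ :354 for this
head BY NAME and threads conjuncts 1∕3∕4 into ★ `TypeTwoHermitianShiftIntegralCM` ∕ ★ `TypeTwoHermitianShiftOrderCM` (this seat) and conjuncts 5–11 into ★ p853677
`exists_local_coe_eq_hermitianMoebius` ∕ `coe_endoEmbLocal_eq_genMoebius` and ★ p853684 (A3)-θ.  Count-neutral CM glue; nothing printed is asserted.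
HONEST LABEL: L2-3 remains THE WALL at the CM-glue layer until every row of CENSUS-L23-CM is paid and `stub_liftInterior_dy` lands; HC_CM is proved only modulo the 7 printed
citations (2 remaining: hLiu418 = stmt-HodgeConjecture-24832, h413 = stmt-HodgeConjecture-24833) until rung 0 closes.

## References
* [Kottwitz1986BaseChangeUnits] R. E. Kottwitz, *Base change for unit elements of Hecke algebras*, Compositio Math. 60 (1986): §2 pp. 244–247.
* [Rogawski1990] J. D. Rogawski, *Automorphic Representations of Unitary Groups in Three Variables*, Ann. of Math. Stud. 123 (1990): §4.9 Prop. 4.9.1 (b) p. 55.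
* [Serre1980Trees] J.-P. Serre, *Trees* (1980): Ch. II §1.1–1.2.
-/

set_option autoImplicit false

noncomputable section

open NumberField IsDedekindDomain Matrix Polynomial
open scoped MatrixGroups WithZero Valued

namespace Literature.NumberTheory.Rogawski1990

open Literature.NumberTheory.Automorphic Literature.NumberTheory.Automorphic.UnitaryGroup Literature.NumberTheory.Automorphic.MoebiusShift
  Literature.NumberTheory.Automorphic.UnitaryLatticeTree Literature.NumberTheory.GaloisRepresentations Literature.NumberTheory.NumberFields

variable (L : Type) [Field L] [NumberField L] [IsCMField L] (v : HeightOneSpectrum (𝓞 ↥(maximalRealSubfield L)))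
  (w : PlacesOver L v) (hw : IsCMField.complexConj L • w.1 = w.1)

include hw in
/-- **«DEEP-DENOMINATORS-θ» — THE HERMITIAN-SHIFT DENOMINATORS OF A 2-DEEP TYPE-(2) `γ_H` ARE UNITS** (the eleven conjuncts of ★ γ₃ `isUnit_shift_denominators_of_typeTwo` ∕
«BINDERS-θ TYPE (2)» §1 for the pair `(θ, c−θ ∣ c−θ′, θ′)`, from 2-deepness alone): at a non-split place (`σ • w = w`), for `|c_w| = exp(−1)`, `θ + θ′ = 1`, `|θ_w| ≤ 1`
and `γ_H = (g, u)` with `g_w ≡ 1`, `u_w ≡ 1 (mod c_w²)` entrywise: `|det((c−θ′)•g + θ′•1)|_w = |det(θ•g + (c−θ)•1)|_w = exp(−2)`, `|(c−θ′)u + θ′|_w = |θu + (c−θ)|_w = exp(−1)`,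
and the seven `E_v`-level units (the four, the two `Fin 1` determinants, `det((c−θ′)•ι(γ_H) + θ′•1)`).  No discriminant hypothesis, no unitarity, no `|2|_w = 1`.
[cite: Kottwitz1986BaseChangeUnits, §2 pp. 244–247] [cite: Rogawski1990, §4.9 Prop. 4.9.1 (b) p. 55] [cite: Serre1980Trees, Ch. II §1.1–1.2] -/
theorem isUnit_hermitianShift_denominators_of_twoDeep
    (γH : (cmDatum L 2 (Matrix.of fun i j : Fin 2 => if i.val + j.val + 1 = 2 then (1 : L) else 0)).Local v ×
      (cmDatum L 1 (Matrix.of fun i j : Fin 1 => if i.val + j.val + 1 = 1 then (1 : L) else 0)).Local v)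
    {c θ θ' : LocalRing L v} (hc : Valued.v (c w) = WithZero.exp (-1 : ℤ)) (hθ : θ + θ' = 1) (hθv : Valued.v (θ w) ≤ 1)
    (hg2 : ∀ i j, Valued.v ((((γH.1.val : GL (Fin 2) (LocalRing L v)).val.map (Pi.evalRingHom (fun w' : PlacesOver L v => w'.1.adicCompletion L) w)) - 1) i j) ≤
      Valued.v (c w) ^ 2)
    (hu2 : Valued.v (finGammaTwo L v γH w - 1) ≤ Valued.v (c w) ^ 2) :
    Valued.v ((((c - θ') • ((γH.1.val : GL (Fin 2) (LocalRing L v)).val : Matrix (Fin 2) (Fin 2) (LocalRing L v)) + θ' • (1 : Matrix (Fin 2) (Fin 2) (LocalRing L v))).det) w) =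
        WithZero.exp (-2 : ℤ) ∧
      Valued.v (((θ • ((γH.1.val : GL (Fin 2) (LocalRing L v)).val : Matrix (Fin 2) (Fin 2) (LocalRing L v)) + (c - θ) • (1 : Matrix (Fin 2) (Fin 2) (LocalRing L v))).det) w) =
        WithZero.exp (-2 : ℤ) ∧
      Valued.v (((c - θ') * finGammaTwo L v γH + θ') w) = WithZero.exp (-1 : ℤ) ∧
      Valued.v ((θ * finGammaTwo L v γH + (c - θ)) w) = WithZero.exp (-1 : ℤ) ∧
      IsUnit ((((c - θ') • ((γH.1.val : GL (Fin 2) (LocalRing L v)).val : Matrix (Fin 2) (Fin 2) (LocalRing L v)) + θ' • (1 : Matrix (Fin 2) (Fin 2) (LocalRing L v))).det)) ∧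
      IsUnit (((θ • ((γH.1.val : GL (Fin 2) (LocalRing L v)).val : Matrix (Fin 2) (Fin 2) (LocalRing L v)) + (c - θ) • (1 : Matrix (Fin 2) (Fin 2) (LocalRing L v))).det)) ∧
      IsUnit ((c - θ') * finGammaTwo L v γH + θ') ∧ IsUnit (θ * finGammaTwo L v γH + (c - θ)) ∧
      IsUnit ((((c - θ') • ((γH.2.val : GL (Fin 1) (LocalRing L v)).val : Matrix (Fin 1) (Fin 1) (LocalRing L v)) + θ' • (1 : Matrix (Fin 1) (Fin 1) (LocalRing L v))).det)) ∧
      IsUnit (((θ • ((γH.2.val : GL (Fin 1) (LocalRing L v)).val : Matrix (Fin 1) (Fin 1) (LocalRing L v)) + (c - θ) • (1 : Matrix (Fin 1) (Fin 1) (LocalRing L v))).det)) ∧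
      IsUnit (((c - θ') • (((endoEmbLocal L v γH).val : GL (Fin 3) (LocalRing L v)).val : Matrix (Fin 3) (Fin 3) (LocalRing L v)) +
        θ' • (1 : Matrix (Fin 3) (Fin 3) (LocalRing L v))).det) := by
  have hv : Subsingleton (PlacesOver L v) := PlacesOver.subsingleton_of_smul_eq (IsCMField.complexConj L) (IsCMField.complexConj_ne_one L) w hw
  set evw : LocalRing L v →+* w.1.adicCompletion L := Pi.evalRingHom (fun w' : PlacesOver L v => w'.1.adicCompletion L) w with hevw
  set gw : Matrix (Fin 2) (Fin 2) (w.1.adicCompletion L) := ((γH.1.val : GL (Fin 2) (LocalRing L v)).val.map evw) with hgw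
  set uw : w.1.adicCompletion L := finGammaTwo L v γH w with huw
  set cw : w.1.adicCompletion L := c w with hcw
  set θw : w.1.adicCompletion L := θ w with hθwdef
  set θ'w : w.1.adicCompletion L := θ' w with hθ'wdef
  obtain ⟨hc0, hc1, -, -, -, -⟩ := shift_parameter_facts hc
  have hvc0 : Valued.v cw ≠ 0 := (Valuation.ne_zero_iff _).2 hc0
  have e2 : Valued.v cw ^ 2 = WithZero.exp (-2 : ℤ) := by rw [hc, ← WithZero.exp_nsmul]; norm_num
  -- the scalars at `w`: `θ_w + θ′_w = 1`, so `θ′_w`, `c_w − θ′_w`, `c_w − θ_w` are integral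
  have hθw : θw + θ'w = 1 := congrFun hθ w
  have hθ'v : Valued.v θ'w ≤ 1 := by
    rw [show θ'w = 1 - θw by rw [← hθw]; ring]
    exact (Valuation.map_sub _ _ _).trans (max_le (le_of_eq (Valuation.map_one _)) hθv)
  have htv : Valued.v (cw - θ'w) ≤ 1 := (Valuation.map_sub _ _ _).trans (max_le hc1.le hθ'v)
  -- `g_w = 1 + c_w X`, `u_w = 1 + c_w y` with `X ≡ 0`, `y ≡ 0 (mod c_w)` (2-deepness)
  set X : Matrix (Fin 2) (Fin 2) (w.1.adicCompletion L) := cw⁻¹ • (gw - 1) with hX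
  have hgX : gw = 1 + cw • X := eq_one_add_smul_inv_smul_sub_one hc0 gw
  have hXc : ∀ i j, Valued.v (X i j) ≤ Valued.v cw := by
    intro i j
    rw [hX, Matrix.smul_apply, smul_eq_mul, map_mul, map_inv₀]
    calc (Valued.v cw)⁻¹ * Valued.v ((gw - 1) i j) ≤ (Valued.v cw)⁻¹ * Valued.v cw ^ 2 := mul_le_mul_right (hg2 i j) _
      _ = Valued.v cw := by rw [sq, ← mul_assoc, inv_mul_cancel₀ hvc0, one_mul]
  set y : w.1.adicCompletion L := cw⁻¹ * (uw - 1) with hy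
  have huy : uw = 1 + cw * y := by rw [hy, ← mul_assoc, mul_inv_cancel₀ hc0, one_mul, add_sub_cancel]
  have hyc : Valued.v y ≤ Valued.v cw := by
    rw [hy, map_mul, map_inv₀]
    calc (Valued.v cw)⁻¹ * Valued.v (uw - 1) ≤ (Valued.v cw)⁻¹ * Valued.v cw ^ 2 := mul_le_mul_right hu2 _
      _ = Valued.v cw := by rw [sq, ← mul_assoc, inv_mul_cancel₀ hvc0, one_mul]
  -- the cofactors `1 + tX`, `1 + ty` (`t` integral) are unimodular
  have hdetX : ∀ {t : w.1.adicCompletion L}, Valued.v t ≤ 1 → Valued.v (((1 : Matrix (Fin 2) (Fin 2) (w.1.adicCompletion L)) + t • X).det) = 1 := by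
    intro t ht
    refine v_det_eq_one_of_forall_v_sub_one_lt_one _ fun i k => ?_
    rw [add_sub_cancel_left, Matrix.smul_apply, smul_eq_mul, map_mul]
    exact lt_of_le_of_lt (mul_le_of_le_one_left' ht) ((hXc i k).trans_lt hc1)
  have hscy : ∀ {t : w.1.adicCompletion L}, Valued.v t ≤ 1 → Valued.v (1 + t * y) = 1 := by
    intro t ht
    refine Valuation.map_one_add_of_lt _ ?_
    rw [map_mul]
    exact lt_of_le_of_lt (mul_le_of_le_one_left' ht) (hyc.trans_lt hc1)
  -- reading the `E_v`-elements at `w`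
  have hdet2w : ∀ a b : LocalRing L v, ((a • ((γH.1.val : GL (Fin 2) (LocalRing L v)).val : Matrix (Fin 2) (Fin 2) (LocalRing L v)) + b • (1 : Matrix (Fin 2) (Fin 2) (LocalRing L v))).det) w =
      (a w • gw + b w • (1 : Matrix (Fin 2) (Fin 2) (w.1.adicCompletion L))).det := fun a b => by
    have e1 : ((a • ((γH.1.val : GL (Fin 2) (LocalRing L v)).val : Matrix (Fin 2) (Fin 2) (LocalRing L v)) + b • (1 : Matrix (Fin 2) (Fin 2) (LocalRing L v))).det) w =
        evw ((a • ((γH.1.val : GL (Fin 2) (LocalRing L v)).val : Matrix (Fin 2) (Fin 2) (LocalRing L v)) + b • (1 : Matrix (Fin 2) (Fin 2) (LocalRing L v))).det) := rfl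
    rw [e1, RingHom.map_det, RingHom.mapMatrix_apply, map_smul_add_smul_one]
    rfl
  have hdet1 : ∀ a b : LocalRing L v, ((a • ((γH.2.val : GL (Fin 1) (LocalRing L v)).val : Matrix (Fin 1) (Fin 1) (LocalRing L v)) + b • (1 : Matrix (Fin 1) (Fin 1) (LocalRing L v))).det) w =
      a w * uw + b w := fun a b => by
    have e1 : ((a • ((γH.2.val : GL (Fin 1) (LocalRing L v)).val : Matrix (Fin 1) (Fin 1) (LocalRing L v)) + b • (1 : Matrix (Fin 1) (Fin 1) (LocalRing L v))).det) w =
        evw ((a • ((γH.2.val : GL (Fin 1) (LocalRing L v)).val : Matrix (Fin 1) (Fin 1) (LocalRing L v)) + b • (1 : Matrix (Fin 1) (Fin 1) (LocalRing L v))).det) := rfl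
    rw [e1, Matrix.det_fin_one]
    simp [evw, uw, finGammaTwo]
  have hsc1 : ∀ a b : LocalRing L v, ((a * finGammaTwo L v γH + b) w) = a w * uw + b w := fun a b => rfl
  -- the four `w`-valuations
  have hw2m : Valued.v ((((c - θ') • ((γH.1.val : GL (Fin 2) (LocalRing L v)).val : Matrix (Fin 2) (Fin 2) (LocalRing L v)) + θ' • (1 : Matrix (Fin 2) (Fin 2) (LocalRing L v))).det) w) =
      WithZero.exp (-2 : ℤ) := by
    rw [hdet2w, show (c - θ') w = cw - θ'w from rfl, show θ' w = θ'w from rfl, hgX, smul_one_add_smul_add_smul_one_of_add_eq X cw (cw - θ'w) θ'w (by ring), Matrix.det_smul,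
      Fintype.card_fin, map_mul, map_pow, hdetX htv, mul_one, e2]
  have hw2p : Valued.v (((θ • ((γH.1.val : GL (Fin 2) (LocalRing L v)).val : Matrix (Fin 2) (Fin 2) (LocalRing L v)) + (c - θ) • (1 : Matrix (Fin 2) (Fin 2) (LocalRing L v))).det) w) =
      WithZero.exp (-2 : ℤ) := by
    rw [hdet2w, show (c - θ) w = cw - θw from rfl, show θ w = θw from rfl, hgX, smul_one_add_smul_add_smul_one_of_add_eq X cw θw (cw - θw) (by ring), Matrix.det_smul,
      Fintype.card_fin, map_mul, map_pow, hdetX hθv, mul_one, e2]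
  have hw1m : Valued.v (((c - θ') * finGammaTwo L v γH + θ') w) = WithZero.exp (-1 : ℤ) := by
    rw [hsc1, show (c - θ') w = cw - θ'w from rfl, show θ' w = θ'w from rfl]
    have e : (cw - θ'w) * uw + θ'w = cw * (1 + (cw - θ'w) * y) := by rw [huy]; ring
    rw [e, map_mul, hc, hscy htv, mul_one]
  have hw1p : Valued.v ((θ * finGammaTwo L v γH + (c - θ)) w) = WithZero.exp (-1 : ℤ) := by
    rw [hsc1, show (c - θ) w = cw - θw from rfl, show θ w = θw from rfl]
    have e : θw * uw + (cw - θw) = cw * (1 + θw * y) := by rw [huy]; ring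
    rw [e, map_mul, hc, hscy hθv, mul_one]
  -- the `E_v`-level units (one place above `v`)
  have hne : ∀ {x : LocalRing L v} {z : ℤ}, Valued.v (x w) = WithZero.exp z → IsUnit x := fun {x z} hx =>
    isUnit_localRing_of_ne_zero_of_subsingleton L v hv fun h0 => by rw [h0, Pi.zero_apply, map_zero] at hx; exact WithZero.zero_ne_coe hx
  have hU2m := hne hw2m
  have hU2p := hne hw2p
  have hU1m := hne hw1m
  have hU1p := hne hw1p
  have hU1m' : IsUnit ((((c - θ') • ((γH.2.val : GL (Fin 1) (LocalRing L v)).val : Matrix (Fin 1) (Fin 1) (LocalRing L v)) + θ' • (1 : Matrix (Fin 1) (Fin 1) (LocalRing L v))).det)) :=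
    hne (z := -1) (by rw [hdet1]; exact hw1m)
  have hU1p' : IsUnit (((θ • ((γH.2.val : GL (Fin 1) (LocalRing L v)).val : Matrix (Fin 1) (Fin 1) (LocalRing L v)) + (c - θ) • (1 : Matrix (Fin 1) (Fin 1) (LocalRing L v))).det)) :=
    hne (z := -1) (by rw [hdet1]; exact hw1p)
  refine ⟨hw2m, hw2p, hw1m, hw1p, hU2m, hU2p, hU1m, hU1p, hU1m', hU1p', ?_⟩
  -- the `3 × 3` denominator of `ι(γ_H)`: block diagonal
  have e3 : (c - θ') • (((endoEmbLocal L v γH).val : GL (Fin 3) (LocalRing L v)).val : Matrix (Fin 3) (Fin 3) (LocalRing L v)) + θ' • (1 : Matrix (Fin 3) (Fin 3) (LocalRing L v)) =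
      Matrix.reindex endoPerm endoPerm (Matrix.fromBlocks
        ((c - θ') • ((γH.1.val : GL (Fin 2) (LocalRing L v)).val : Matrix (Fin 2) (Fin 2) (LocalRing L v)) + θ' • (1 : Matrix (Fin 2) (Fin 2) (LocalRing L v))) 0 0
        ((c - θ') • ((γH.2.val : GL (Fin 1) (LocalRing L v)).val : Matrix (Fin 1) (Fin 1) (LocalRing L v)) + θ' • (1 : Matrix (Fin 1) (Fin 1) (LocalRing L v)))) := by
    rw [coe_endoEmbLocal, coe_endoGL, smul_reindex_add_smul_one, smul_fromBlocks_add_smul_one]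
  rw [e3, Matrix.det_reindex_self, Matrix.det_fromBlocks_zero₁₂]
  exact hU2m.mul hU1m'

end Literature.NumberTheory.Rogawski1990

end
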